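import Summits.Ventures.QEC.Census.CSSNormalFormSAT.EncodeSoundSym
import Summits.Ventures.QEC.Census.CSSNormalFormSAT.UnsatB9W7
import Summits.Ventures.QEC.Census.CSSNormalFormSAT.UnsatB10W5
import Summits.Ventures.QEC.Census.CSSNormalFormSAT.UnsatB10W6
import Summits.Ventures.QEC.Census.CSSNormalFormSAT.UnsatB11W5
import HarnessLib

/-!
# No Boolean `k = 1` normal form at `(n,d) = (16,5)` for the splits `(b,w) ∈ {(9,7), (10,5), (10,6), (11,5)}` (KERNEL-PLAN item 5, first cases)

LADDER-QEC census cell `(16,1)` (census/type-02/css161/KERNEL-PLAN.md). Combining the encoder soundness (`EncodeSoundSym.false_of_unsat`: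
a Boolean matrix `P` with the counting conditions `ZCond`/`XCond` and the double-lex condition `LexCond` yields a model of `NFEnc.fmla c`)
with the kernel LRAT refutations `unsat_nf16_b<b>_w<w>` gives: there is NO such `P` for these four `(b,w)`. (The remaining six splits
`b ∈ {8,9}` come from the cube-covered instances; the bridge from `CSSNormalForm.exists_normalForm` and the double-lex representative lemma
then yield «no CSS [[16,1,5]]».) Theorems only; axioms standard. [folklore]
-/

set_option autoImplicit false

namespace Summit.Ventures.QEC.Census.CSSNormalFormSAT

/-- No Boolean normal form for `(b,w) = (9,7)`. [folklore] -/
theorem noNF_16_5_b9_w7 (P : ℕ → ℕ → Bool) (hZ : ZCond ⟨16, 5, 9, 7⟩ P) (hX : XCond ⟨16, 5, 9, 7⟩ P)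
    (hL : LexCond ⟨16, 5, 9, 7⟩ P) : False :=
  false_of_unsat ⟨16, 5, 9, 7⟩ P (by decide) (by decide) hZ hX hL unsat_nf16_b9_w7

/-- No Boolean normal form for `(b,w) = (10,5)`. [folklore] -/
theorem noNF_16_5_b10_w5 (P : ℕ → ℕ → Bool) (hZ : ZCond ⟨16, 5, 10, 5⟩ P) (hX : XCond ⟨16, 5, 10, 5⟩ P)
    (hL : LexCond ⟨16, 5, 10, 5⟩ P) : False :=
  false_of_unsat ⟨16, 5, 10, 5⟩ P (by decide) (by decide) hZ hX hL unsat_nf16_b10_w5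

/-- No Boolean normal form for `(b,w) = (10,6)`. [folklore] -/
theorem noNF_16_5_b10_w6 (P : ℕ → ℕ → Bool) (hZ : ZCond ⟨16, 5, 10, 6⟩ P) (hX : XCond ⟨16, 5, 10, 6⟩ P)
    (hL : LexCond ⟨16, 5, 10, 6⟩ P) : False :=
  false_of_unsat ⟨16, 5, 10, 6⟩ P (by decide) (by decide) hZ hX hL unsat_nf16_b10_w6

/-- No Boolean normal form for `(b,w) = (11,5)`. [folklore] -/
theorem noNF_16_5_b11_w5 (P : ℕ → ℕ → Bool) (hZ : ZCond ⟨16, 5, 11, 5⟩ P) (hX : XCond ⟨16, 5, 11, 5⟩ P)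
    (hL : LexCond ⟨16, 5, 11, 5⟩ P) : False :=
  false_of_unsat ⟨16, 5, 11, 5⟩ P (by decide) (by decide) hZ hX hL unsat_nf16_b11_w5

end Summit.Ventures.QEC.Census.CSSNormalFormSAT
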